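import Summits.HodgeConjecture.HodgeConjecture.Theorems.CYFormCasimirCYFormSquarePrincipleCup
import Literature.AlgebraicGeometry.HodgeTheory.ExpTwistClassesExponentialLaw
import HarnessLib

/-!
# Crux X3 `CYFormSquarePrinciple` (route `CYFormCasimir`, stmt-HodgeConjecture-23494), helper file 5b:
# (A2) the Casimir principle — a non-zero Hodge class in `span(T·T)` has non-zero Weil component

research route conditional on HC_CM; not a corollary. Nothing here proves HC, HC_CM or any rung.

Setting of the crux on a Hodge-general (`Hg = SU_H`) hyperbolic Weil eightfold `(A, φ)` with CY form
`T ⊂ H⁴(A(ℂ); ℂ)`. By the tree's van Geemen 6.12 (`exists_repr_of_mem_hodgeClassSpan_mid`) a Hodge class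
`κ ∈ H⁸` is `r h_K⁴ + b T₊ + c T₋`. THIS FILE: if `κ` lies in `span{u ∪ v | u, v ∈ T}` and `b = c = 0` then
`κ = 0` (`eq_zero_of_mem_span_cup_of_weil_zero`). Mechanism (no sign computation): with the projection
`π_T : ⋀⁴W ⊕ ⋀⁴W^* = T ⊕ ⋀⁴W → T` (`exists_cyProjector`, `SU_H`-equivariant by (A1), helper file 4c) and the
rational operator `Q` onto `⋀⁴W ⊕ ⋀⁴W^*` (helper file 4b), the bilinear forms
`E_z(x, y) = ℓ(z ∪ π_T Q x ∪ π_T Q y)` (`z = h_K⁴, T₊`; `ℓ` a functional on the top line `H¹⁶ = ℂ h_K⁸`) are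
invariant under the diagonal torus and the signed transpositions of `SU_H(ℂ)`, so by the uniqueness of such
forms on `⋀⁴W^*` (helper file 3, "(Sym² ⋀⁴)^{SL₈} = ℂ") `E_{T₊}(p₀) E_{h⁴} = E_{h⁴}(p₀) E_{T₊}` on
`⋀⁴W^* × ⋀⁴W^*`, where `E_{T₊}(p₀) = ± q(β⁴)² ℓ(w₁ ∪ ⋯ ∪ w*₈) ≠ 0`; hence
`E_{T₊}(p₀) ℓ(h⁴ ∪ κ) = E_{h⁴}(p₀) ℓ(T₊ ∪ κ)` for `κ ∈ span(T·T)`, and for `κ = r h⁴`: `T₊ ∪ h⁴ = 0`,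
`ℓ(h⁸) ≠ 0`, so `r = 0`.

References: vanGeemen1994HodgeAV (Lemma 6.10, Thm. 6.12 and proof), vanGeemenRapagnetta2026WeilHK (§1.11–1.15:
the Casimir / Beauville–Bogomolov class restricts to `θ² +` (non-zero Weil class) one weight down),
FriedmanLaza2013 (§3.5 Prop. 37), Deligne1982HodgeCycles (I §3).
-/

-- `Summit.HodgeConjecture.HodgeConjecture.…` is the tree's mandated summit/problem namespace (single-problem summit).
set_option linter.dupNamespace false
noncomputable section

open CategoryTheory
open Literature.AlgebraicTopology.SingularHomology
open Literature.AlgebraicGeometry.Motives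
open Literature.AlgebraicGeometry.HodgeTheory
open Literature.AlgebraicGeometry.VanGeemen1994

namespace Summit.HodgeConjecture.HodgeConjecture.Theorems.CYFormSquare

section Casimir

variable {A : AbelianVariety ℂ} {d : ℕ} {φ : A ⟶ A}
variable (hn : 2 ≤ 4) (hd : 0 < d) (hA : A.dim = 2 * 4) (hφ : φ ≫ φ = -(d • 𝟙 A))
  (e : ProjectiveEmbedding A.X) {a : complexBetti (projectiveSpace e.n ℂ) 2} (ha : IsRationalClass a)
  (ha0 : a ≠ 0)
  (hSU : HasHodgeGroupSU A φ 4 d (hK d φ e a))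
  {T : Submodule ℂ (complexBetti A.X (2 * 2))}
  (hTle : T ≤ weilClassesPlus A φ 2 d ⊔ weilClassesMinus A φ 2 d)
  (hT0 : T ⊓ weilClassesPlus A φ 2 d = ⊥)
  (hT70 : Module.finrank ℂ T = 70)
  (hTrat : T ≤ Submodule.span ℂ {c | c ∈ T ∧ IsRationalClass c})
  (hThs : T ≤ Submodule.span ℂ {c | c ∈ T ∧ ∃ p q : ℕ, p + q = 4 ∧ IsOfHodgeType (2 * 4) A.X (2 * 2) p q c})

include hn hd hA hφ e ha ha0 hTle hT0 hT70 hTrat in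
/-- `T ⊕ ⋀⁴W = ⋀⁴W ⊕ ⋀⁴W^*` (dimension count: `dim(⋀⁴W ⊕ ⋀⁴W^*) = 140`, `dim ⋀⁴W^* ≤ 70`).
[cite: FriedmanLaza2013, §3.5 Prop. 37] -/
theorem sup_weilClassesPlus_eq : T ⊔ weilClassesPlus A φ 2 d = weilClassesPlus A φ 2 d ⊔ weilClassesMinus A φ 2 d := by
  haveI := finite_complexBetti_abelianVariety A (2 * 2)
  refine Submodule.eq_of_le_of_finrank_le (sup_le hTle le_sup_left) ?_
  have h1 := Submodule.finrank_sup_add_finrank_inf_eq T (weilClassesPlus A φ 2 d)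
  rw [hT0, finrank_bot, add_zero, hT70] at h1
  have h2 : Module.finrank ℂ ↥(weilClassesPlus A φ 2 d ⊔ weilClassesMinus A φ 2 d) = 70 + 70 := by
    have h := Submodule.finrank_sup_add_finrank_inf_eq T
      (T.map (complexBetti.map ((1 : ℕ) • 𝟙 A + (2 : ℕ) • φ).hom.hom.hom (2 * 2)).hom)
    rw [sup_map_testOp_eq hn hd hA hφ e ha ha0 hTle hT0 hT70 hTrat, inf_map_testOp_eq_bot hd hTle hT0 hTrat, finrank_bot,
      add_zero, hT70, finrank_map_testOp hd hTle hT70] at h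
    exact h
  have h3 := Submodule.finrank_add_le_finrank_add_finrank (weilClassesPlus A φ 2 d) (weilClassesMinus A φ 2 d)
  have h4 := finrank_weilClassesMinus_two_le hn hd hA hφ e ha ha0
  omega

include hn hd hA hφ e ha ha0 hSU hTle hT0 hT70 hTrat hThs in
/-- **The projector of `⋀⁴W ⊕ ⋀⁴W^* = T ⊕ ⋀⁴W` onto `T`**, extended to `H⁴`: a linear `π` with values in `T`,
`π y - y ∈ ⋀⁴W` for `y ∈ ⋀⁴W^*`, every `t ∈ T` of the form `π y` (`y ∈ ⋀⁴W^*`), and `SU_H`-EQUIVARIANT on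
`⋀⁴W ⊕ ⋀⁴W^*` (by (A1): `⋀⁴u` preserves `T` and `⋀⁴W`). [cite: vanGeemenRapagnetta2026WeilHK, §1.15] -/
theorem exists_cyProjector :
    ∃ π : complexBetti A.X (2 * 2) →ₗ[ℂ] complexBetti A.X (2 * 2),
      (∀ v, π v ∈ T) ∧
      (∀ y ∈ weilClassesMinus A φ 2 d, π y - y ∈ weilClassesPlus A φ 2 d) ∧
      (∀ t ∈ T, ∃ y ∈ weilClassesMinus A φ 2 d, π y = t) ∧
      (∀ u ∈ weilSpecialUnitaryGroup A φ 4 d (hK d φ e a), ∀ v ∈ weilClassesPlus A φ 2 d ⊔ weilClassesMinus A φ 2 d,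
        extAct (u : complexBetti A.X 1 →ₗ[ℂ] complexBetti A.X 1) (2 * 2) (π v) =
          π (extAct (u : complexBetti A.X 1 →ₗ[ℂ] complexBetti A.X 1) (2 * 2) v)) := by
  set R := weilClassesPlus A φ 2 d ⊔ weilClassesMinus A φ 2 d with hR
  have hTR : T ⊔ weilClassesPlus A φ 2 d = R := sup_weilClassesPlus_eq hn hd hA hφ e ha ha0 hTle hT0 hT70 hTrat
  obtain ⟨K, hK'⟩ := Submodule.exists_isCompl R
  have hc : IsCompl T (weilClassesPlus A φ 2 d ⊔ K) := by
    refine ⟨?_, ?_⟩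
    · rw [Submodule.disjoint_def]
      intro x hxT hx
      obtain ⟨p, hp, k, hk, hpk⟩ := Submodule.mem_sup.1 hx
      have hkR : k ∈ R := by
        have e1 : k = x - p := by rw [← hpk]; abel
        rw [e1]; exact Submodule.sub_mem _ (hTle hxT) (Submodule.mem_sup_left hp)
      have hk0 : k = 0 := by have := hK'.1; rw [Submodule.disjoint_def] at this; exact this k hkR hk
      rw [hk0, add_zero] at hpk
      have : x ∈ T ⊓ weilClassesPlus A φ 2 d := ⟨hxT, hpk ▸ hp⟩
      rwa [hT0, Submodule.mem_bot] at this
    · rw [codisjoint_iff, ← sup_assoc, hTR]; exact hK'.2.eq_top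
  refine ⟨T.projection _ hc, fun v ↦ Submodule.projection_apply_mem hc _, fun y hy ↦ ?_, fun t ht ↦ ?_, fun u hu v hv ↦ ?_⟩
  · -- `π y - y ∈ ⋀⁴W`
    have h1 : y - T.projection _ hc y ∈ weilClassesPlus A φ 2 d ⊔ K := Submodule.sub_projection_mem hc y
    obtain ⟨p, hp, k, hk, hpk⟩ := Submodule.mem_sup.1 h1
    have hkR : k ∈ R := by
      have e1 : k = (y - T.projection _ hc y) - p := by rw [← hpk]; abel
      rw [e1]
      exact Submodule.sub_mem _ (Submodule.sub_mem _ (Submodule.mem_sup_right hy)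
        (hTle (Submodule.projection_apply_mem hc _))) (Submodule.mem_sup_left hp)
    have hk0 : k = 0 := by have := hK'.1; rw [Submodule.disjoint_def] at this; exact this k hkR hk
    rw [hk0, add_zero] at hpk
    have e2 : T.projection _ hc y - y = -p := by rw [← neg_sub, hpk]
    rw [e2]; exact Submodule.neg_mem _ hp
  · -- `t = π y` for the `⋀⁴W^*`-component `y` of `t`
    obtain ⟨x, hx, y, hy, hxy⟩ := Submodule.mem_sup.1 (hTle ht)
    refine ⟨y, hy, ?_⟩
    have e1 : y = t - x := by rw [← hxy]; abel
    rw [e1, map_sub, Submodule.projection_apply_of_mem_left hc ht,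
      (Submodule.projection_apply_eq_zero_iff hc).2 (Submodule.mem_sup_left hx), sub_zero]
  · -- equivariance on `R = T ⊕ ⋀⁴W`
    rw [← hTR] at hv
    obtain ⟨t, ht, x, hx, rfl⟩ := Submodule.mem_sup.1 hv
    have hux : extAct (u : complexBetti A.X 1 →ₗ[ℂ] complexBetti A.X 1) (2 * 2) x ∈ weilClassesPlus A φ 2 d :=
      extAct_mem_pullbackEigenclasses (mem_weilSpecialUnitaryGroup_iff.1 hu).1 hx
    have hut : extAct (u : complexBetti A.X 1 →ₗ[ℂ] complexBetti A.X 1) (2 * 2) t ∈ T :=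
      extAct_mem_cyForm_of_mem_weilSpecialUnitaryGroup hn hd hA hφ e ha ha0 hTle hT0 hT70 hTrat hThs hSU hu ht
    have e1 : T.projection _ hc (t + x) = t := by
      rw [map_add, Submodule.projection_apply_of_mem_left hc ht,
        (Submodule.projection_apply_eq_zero_iff hc).2 (Submodule.mem_sup_left hx), add_zero]
    have e2 : T.projection _ hc (extAct (u : complexBetti A.X 1 →ₗ[ℂ] complexBetti A.X 1) (2 * 2) (t + x)) =
        extAct (u : complexBetti A.X 1 →ₗ[ℂ] complexBetti A.X 1) (2 * 2) t := by
      rw [map_add, map_add, Submodule.projection_apply_of_mem_left hc hut,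
        (Submodule.projection_apply_eq_zero_iff hc).2 (Submodule.mem_sup_left hux), add_zero]
    rw [e1, e2]

include hn hd hA hφ e ha ha0 hSU hTle hT0 hT70 hTrat hThs in
/-- **(A2) The Casimir principle.** If `κ ∈ span{u ∪ v | u, v ∈ T} ⊂ H⁸(A(ℂ); ℂ)` equals `r • h_K⁴` for some
`r ∈ ℂ` (no Weil component), then `κ = 0` (Weil classes of Hodge type `(4,4)` assumed, `hW`, as holds in the
hyperbolic case). [cite: vanGeemen1994HodgeAV, Thm. 6.12 and its proof] [cite: vanGeemenRapagnetta2026WeilHK, §1.11–1.15] -/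
theorem eq_zero_of_mem_span_cup_of_eq_smul_hK
    (hW : ∀ c ∈ weilClassesOf A φ 4 d, IsOfHodgeType (2 * 4) A.X (2 * 4) 4 4 c) {κ : complexBetti A.X (2 * 4)}
    (hκ : κ ∈ Submodule.span ℂ {x | ∃ u ∈ T, ∃ v ∈ T, x = cupProduct (show 2 * 2 + 2 * 2 = 2 * 4 from rfl) u v})
    {r : ℂ} (hr : κ = r • cupPowTwo (hK d φ e a) 4) : κ = 0 := by
  classical
  haveI := finite_complexBetti_abelianVariety A (2 * 8)
  have h224 : 2 * 2 + 2 * 2 = 2 * 4 := rfl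
  have h848 : 2 * 4 + 2 * 4 = 2 * 8 := rfl
  have hm' : 1 ≤ 2 * 4 - 1 := by norm_num
  have hA' : A.dim = 2 * 4 - 1 + 1 := by omega
  have hbW : bW hn hd hA hφ e ha ha0 = weilBasis hm' hA' hd hφ e ha ha0 (wBasis hd hφ hA) := rfl
  -- the operator `Q`
  set Q : complexBetti A.X (2 * 2) →ₗ[ℂ] complexBetti A.X (2 * 2) :=
    ((complexBetti.map ((1 : ℕ) • 𝟙 A + (2 : ℕ) • φ).hom.hom.hom (2 * 2)).hom - ((1 + 4 * (d : ℂ)) ^ 2) • LinearMap.id) ∘ₗ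
      ((complexBetti.map ((1 : ℕ) • 𝟙 A + (2 : ℕ) • φ).hom.hom.hom (2 * 2)).hom ∘ₗ
          (complexBetti.map ((1 : ℕ) • 𝟙 A + (2 : ℕ) • φ).hom.hom.hom (2 * 2)).hom -
        (2 * (1 + 4 * (d : ℂ)) * (1 - 4 * (d : ℂ))) • (complexBetti.map ((1 : ℕ) • 𝟙 A + (2 : ℕ) • φ).hom.hom.hom (2 * 2)).hom +
        ((1 + 4 * (d : ℂ)) ^ 4) • LinearMap.id) with hQ
  have hQR : ∀ v, Q v ∈ weilClassesPlus A φ 2 d ⊔ weilClassesMinus A φ 2 d :=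
    fun v ↦ testPolyOp_mem_sup hn hd hA hφ e ha ha0 Q hQ v
  set qm : ℂ := ((1 - 2 * Complex.I * (Real.sqrt d : ℂ)) ^ 4 - (1 + 4 * (d : ℂ)) ^ 2) *
      (((1 - 2 * Complex.I * (Real.sqrt d : ℂ)) ^ 4) ^ 2 -
        2 * (1 + 4 * (d : ℂ)) * (1 - 4 * (d : ℂ)) * (1 - 2 * Complex.I * (Real.sqrt d : ℂ)) ^ 4 + (1 + 4 * (d : ℂ)) ^ 4)
    with hqm
  have hqm0 : qm ≠ 0 := testPoly_minus_ne_zero hd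
  have hQm : ∀ y ∈ weilClassesMinus A φ 2 d, Q y = qm • y := fun y hy ↦ by
    have h := (mem_weilClassesMinus_iff.1 hy) 1 2; push_cast at h
    rw [testPolyOp_apply Q hQ h]
  have hQU : ∀ u ∈ weilSpecialUnitaryGroup A φ 4 d (hK d φ e a), ∀ v,
      extAct (u : complexBetti A.X 1 →ₗ[ℂ] complexBetti A.X 1) (2 * 2) (Q v) =
        Q (extAct (u : complexBetti A.X 1 →ₗ[ℂ] complexBetti A.X 1) (2 * 2) v) := by
    intro u hu v
    have hUΨ : ∀ z, extAct (u : complexBetti A.X 1 →ₗ[ℂ] complexBetti A.X 1) (2 * 2)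
        ((complexBetti.map ((1 : ℕ) • 𝟙 A + (2 : ℕ) • φ).hom.hom.hom (2 * 2)).hom z) =
        (complexBetti.map ((1 : ℕ) • 𝟙 A + (2 : ℕ) • φ).hom.hom.hom (2 * 2)).hom
          (extAct (u : complexBetti A.X 1 →ₗ[ℂ] complexBetti A.X 1) (2 * 2) z) :=
      fun z ↦ extAct_testOp_comm (mem_weilSpecialUnitaryGroup_iff.1 hu).1 1 2 (2 * 2) z
    rw [hQ]
    simp only [LinearMap.comp_apply, LinearMap.sub_apply, LinearMap.add_apply, LinearMap.smul_apply, LinearMap.id_apply,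
      map_sub, map_add, map_smul, hUΨ]
  -- the projector `π`
  obtain ⟨π, hπT, hπm, hπsurj, hπU⟩ := exists_cyProjector hn hd hA hφ e ha ha0 hSU hTle hT0 hT70 hTrat hThs
  -- a functional on the top line not killing `h⁸`
  obtain ⟨ℓ, hℓ⟩ : ∃ ℓ : complexBetti A.X (2 * 8) →ₗ[ℂ] ℂ, ℓ (cupPowTwo (hK d φ e a) 8) ≠ 0 := by
    by_contra hne
    simp only [not_exists, not_not] at hne
    exact cupPowTwo_hK_ne_zero hn hd hA hφ e ha ha0 hSU (p := 8) (by norm_num)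
      ((Module.forall_dual_apply_eq_zero_iff ℂ _).1 hne)
  -- the bilinear forms `E_z(x, y) = ℓ(z ∪ π Q x ∪ π Q y)`
  set Ez : complexBetti A.X (2 * 4) → (complexBetti A.X (2 * 2) →ₗ[ℂ] complexBetti A.X (2 * 2) →ₗ[ℂ] ℂ) := fun z ↦
    ((cupProduct h224).compl₁₂ (π ∘ₗ Q) (π ∘ₗ Q)).compr₂ (ℓ ∘ₗ cupProduct h848 z) with hEz
  have hEz_apply : ∀ z x y, Ez z x y = ℓ (cupProduct h848 z (cupProduct h224 (π (Q x)) (π (Q y)))) := fun z x y ↦ rfl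
  -- invariance under `SU_H(ℂ)` for `z` fixed by `⋀⁸u`
  have hinv : ∀ z : complexBetti A.X (2 * 4), (∀ u ∈ weilSpecialUnitaryGroup A φ 4 d (hK d φ e a),
      extAct (u : complexBetti A.X 1 →ₗ[ℂ] complexBetti A.X 1) (2 * 4) z = z) →
      ∀ u ∈ weilSpecialUnitaryGroup A φ 4 d (hK d φ e a), ∀ x y,
        Ez z (extAct (u : complexBetti A.X 1 →ₗ[ℂ] complexBetti A.X 1) (2 * 2) x)
          (extAct (u : complexBetti A.X 1 →ₗ[ℂ] complexBetti A.X 1) (2 * 2) y) = Ez z x y := by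
    intro z hz u hu x y
    rw [hEz_apply, hEz_apply, ← hQU u hu x, ← hQU u hu y, ← hπU u hu _ (hQR x), ← hπU u hu _ (hQR y)]
    change ℓ (cupProduct h848 z (cupProduct h224
      (exteriorPullback (hasExteriorCohomologyH1 A) (u : complexBetti A.X 1 →ₗ[ℂ] complexBetti A.X 1) (2 * 2) (π (Q x)))
      (exteriorPullback (hasExteriorCohomologyH1 A) (u : complexBetti A.X 1 →ₗ[ℂ] complexBetti A.X 1) (2 * 2) (π (Q y))))) = _
    rw [← exteriorPullback_cupProduct]
    conv_lhs => rw [← hz u hu]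
    change ℓ (cupProduct h848 (exteriorPullback (hasExteriorCohomologyH1 A) _ (2 * 4) z)
      (exteriorPullback (hasExteriorCohomologyH1 A) _ (2 * 4) _)) = _
    rw [← exteriorPullback_cupProduct (hasExteriorCohomologyH1 A) _ h848]
    exact congrArg ℓ (extAct_top_eq_self hn hd hA hφ e ha ha0 hSU hu _)
  -- `h⁴` and `T₊` are fixed by `⋀⁸u`
  have hfix4 : ∀ u ∈ weilSpecialUnitaryGroup A φ 4 d (hK d φ e a),
      extAct (u : complexBetti A.X 1 →ₗ[ℂ] complexBetti A.X 1) (2 * 4) (cupPowTwo (hK d φ e a) 4) = cupPowTwo (hK d φ e a) 4 :=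
    fun u hu ↦ extAct_eq_self_of_mem_hodgeClassSpan hSU hu (cupPowTwo_hK_mem_hodgeClassSpan hn hd hA e ha ha0 4)
  have hfixTP : ∀ u ∈ weilSpecialUnitaryGroup A φ 4 d (hK d φ e a),
      extAct (u : complexBetti A.X 1 →ₗ[ℂ] complexBetti A.X 1) (2 * 4) (TP hn hd hA hφ e ha ha0) = TP hn hd hA hφ e ha ha0 :=
    fun u hu ↦ extAct_eq_self_of_mem_hodgeClassSpan hSU hu (weilClassesOf_le_hodgeClassSpan hn hd hA hφ hW
      (weilClassesPlus_le_weilClassesOf A φ 4 d (TP_mem_weilClassesPlus hn hd hA hφ e ha ha0)))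
  -- the reference complementary pair of `w^*`-monomials
  have hJc : 2 * 2 + 2 * 2 = Fintype.card (Fin (2 * 4)) := by rw [Fintype.card_fin]
  set J₀ : Set.powersetCard (Fin (2 * 4)) (2 * 2) :=
    Set.powersetCard.ofCard (s := Finset.univ.filter fun i : Fin (2 * 4) ↦ (i : ℕ) < 2 * 2) (by decide) with hJ₀
  set J₀' : Set.powersetCard (Fin (2 * 4)) (2 * 2) := Set.powersetCard.compl hJc J₀ with hJ₀'
  have hJJ : J₀'.val = J₀.valᶜ := Set.powersetCard.coe_compl
  set y₀ := monB (bW hn hd hA hφ e ha ha0) (2 * 2) (Set.powersetCard.map (2 * 2) (Fin.natAddEmb (2 * 4)) J₀) with hy₀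
  set y₀' := monB (bW hn hd hA hφ e ha ha0) (2 * 2) (Set.powersetCard.map (2 * 2) (Fin.natAddEmb (2 * 4)) J₀') with hy₀'
  have hBm : ∀ J : Set.powersetCard (Fin (2 * 4)) (2 * 2),
      monB (bW hn hd hA hφ e ha ha0) (2 * 2) (Set.powersetCard.map (2 * 2) (Fin.natAddEmb (2 * 4)) J) ∈ weilClassesMinus A φ 2 d := by
    intro J
    refine monB_mem_weilClassesMinus_two hn hd hA hφ e ha ha0 _ ?_
    rw [Finset.card_eq_zero, Finset.eq_empty_iff_forall_notMem]
    intro i hi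
    rw [mem_projW_iff, Set.powersetCard.val_map] at hi
    exact castAdd_not_mem_map_natAddEmb' hi
  -- the combination `E = E₂(p₀) E₁ - E₁(p₀) E₂` vanishes on `⋀⁴W^* × ⋀⁴W^*`
  set E₁ := Ez (cupPowTwo (hK d φ e a) 4) with hE₁
  set E₂ := Ez (TP hn hd hA hφ e ha ha0) with hE₂
  set E := E₂ y₀ y₀' • E₁ - E₁ y₀ y₀' • E₂ with hE
  have hEinv : ∀ u ∈ weilSpecialUnitaryGroup A φ 4 d (hK d φ e a), ∀ x y,
      E (extAct (u : complexBetti A.X 1 →ₗ[ℂ] complexBetti A.X 1) (2 * 2) x)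
        (extAct (u : complexBetti A.X 1 →ₗ[ℂ] complexBetti A.X 1) (2 * 2) y) = E x y := by
    intro u hu x y
    simp only [hE, LinearMap.sub_apply, LinearMap.smul_apply]
    rw [hinv _ hfix4 u hu x y, hinv _ hfixTP u hu x y]
  have hEall : ∀ J J' : Set.powersetCard (Fin (2 * 4)) (2 * 2),
      E (monB (weilBasis hm' hA' hd hφ e ha ha0 (wBasis hd hφ hA)) (2 * 2) (Set.powersetCard.map (2 * 2) (Fin.natAddEmb (2 * 4)) J))
        (monB (weilBasis hm' hA' hd hφ e ha ha0 (wBasis hd hφ hA)) (2 * 2) (Set.powersetCard.map (2 * 2) (Fin.natAddEmb (2 * 4)) J')) = 0 := by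
    refine bilin_natAdd_eq_zero hm' hA' hd hφ e ha ha0 (wBasis hd hφ hA) E rfl (by norm_num) ?_ ?_ J₀ J₀' hJJ ?_
    · intro i₀ i₁ hne x y
      exact hEinv _ (torusAuto_mem hm' hA' hd hφ e ha ha0 (wBasis hd hφ hA) 4 d rfl rfl hne) x y
    · intro a b hab x y
      exact hEinv _ (swapAuto_mem hm' hA' hd hφ e ha ha0 (wBasis hd hφ hA) 4 d rfl rfl hab) x y
    · change E y₀ y₀' = 0
      simp only [hE, LinearMap.sub_apply, LinearMap.smul_apply, smul_eq_mul]
      ring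
  have hEspan : ∀ y ∈ weilClassesMinus A φ 2 d, ∀ y' ∈ weilClassesMinus A φ 2 d, E y y' = 0 := by
    intro y hy y' hy'
    have h1 := weilClassesMinus_two_le_span hn hd hA hφ e ha ha0 hy
    have h2 := weilClassesMinus_two_le_span hn hd hA hφ e ha ha0 hy'
    rw [hbW] at h1 h2
    exact bilin_eq_zero_of_mem_span_natAdd hm' hA' hd hφ e ha ha0 (wBasis hd hφ hA) E hEall h1 h2
  -- read on `T × T`: `E₂(p₀) ℓ(h⁴ ∪ (t ∪ t')) = E₁(p₀) ℓ(T₊ ∪ (t ∪ t'))`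
  have hT2 : ∀ t ∈ T, ∀ t' ∈ T,
      E₂ y₀ y₀' * ℓ (cupProduct h848 (cupPowTwo (hK d φ e a) 4) (cupProduct h224 t t')) =
        E₁ y₀ y₀' * ℓ (cupProduct h848 (TP hn hd hA hφ e ha ha0) (cupProduct h224 t t')) := by
    intro t ht t' ht'
    obtain ⟨y, hy, hyt⟩ := hπsurj t ht
    obtain ⟨y', hy', hyt'⟩ := hπsurj t' ht'
    have hx : π (Q (qm⁻¹ • y)) = t := by rw [map_smul, hQm y hy, smul_smul, inv_mul_cancel₀ hqm0, one_smul, hyt]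
    have hx' : π (Q (qm⁻¹ • y')) = t' := by rw [map_smul, hQm y' hy', smul_smul, inv_mul_cancel₀ hqm0, one_smul, hyt']
    have h := hEspan _ (Submodule.smul_mem _ qm⁻¹ hy) _ (Submodule.smul_mem _ qm⁻¹ hy')
    simp only [hE, LinearMap.sub_apply, LinearMap.smul_apply, smul_eq_mul, hE₁, hE₂, hEz_apply, hx, hx'] at h
    exact sub_eq_zero.1 h
  -- the functional `L = E₂(p₀) ℓ(h⁴ ∪ ·) - E₁(p₀) ℓ(T₊ ∪ ·)` kills `span(T·T)`, hence `κ`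
  set L : complexBetti A.X (2 * 4) →ₗ[ℂ] ℂ :=
    E₂ y₀ y₀' • (ℓ ∘ₗ cupProduct h848 (cupPowTwo (hK d φ e a) 4)) - E₁ y₀ y₀' • (ℓ ∘ₗ cupProduct h848 (TP hn hd hA hφ e ha ha0))
    with hL
  have hLκ : L κ = 0 := by
    have hsub : {x : complexBetti A.X (2 * 4) | ∃ u ∈ T, ∃ v ∈ T, x = cupProduct (show 2 * 2 + 2 * 2 = 2 * 4 from rfl) u v} ⊆
        (LinearMap.ker L : Set (complexBetti A.X (2 * 4))) := by
      rintro _ ⟨u, hu, v, hv, rfl⟩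
      rw [SetLike.mem_coe, LinearMap.mem_ker, hL, LinearMap.sub_apply, LinearMap.smul_apply, LinearMap.smul_apply,
        LinearMap.comp_apply, LinearMap.comp_apply, smul_eq_mul, smul_eq_mul, hT2 u hu v hv, sub_self]
    exact LinearMap.mem_ker.1 (Submodule.span_le.2 hsub hκ)
  -- evaluate at `κ = r • h⁴`: `T₊ ∪ h⁴ = 0`, `h⁴ ∪ h⁴ = h⁸`
  have hh8 : cupProduct h848 (cupPowTwo (hK d φ e a) 4) (cupPowTwo (hK d φ e a) 4) = cupPowTwo (hK d φ e a) 8 :=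
    cupProduct_cupPowTwo_cupPowTwo _ (by norm_num) h848
  rw [hr, map_smul, hL, LinearMap.sub_apply, LinearMap.smul_apply, LinearMap.smul_apply, LinearMap.comp_apply,
    LinearMap.comp_apply, hh8, TP_cup_cupPowTwo_hK_eq_zero hn hd hA hφ e ha ha0 hSU h848] at hLκ
  simp only [map_zero, smul_eq_mul, mul_zero, sub_zero] at hLκ
  -- `E₂(p₀) ≠ 0`
  have hE₂0 : E₂ y₀ y₀' ≠ 0 := by
    -- `π y₀ = y₀ + p`, `π y₀' = y₀' + p'` with `p, p' ∈ ⋀⁴W`, killed by `T₊`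
    have hkill : ∀ p ∈ weilClassesPlus A φ 2 d, ∀ v : complexBetti A.X (2 * 2),
        cupProduct h848 (TP hn hd hA hφ e ha ha0) (cupProduct h224 p v) = 0 ∧
          cupProduct h848 (TP hn hd hA hφ e ha ha0) (cupProduct h224 v p) = 0 := by
      intro p hp v
      have h1 : cupProduct h848 (TP hn hd hA hφ e ha ha0) (cupProduct h224 p v) = 0 := by
        rw [← cupProduct_assoc (show 2 * 4 + 2 * 2 = 2 * 6 from rfl) h224 (show 2 * 6 + 2 * 2 = 2 * 8 from rfl) h848,
          TP_cup_eq_zero_of_mem_weilClassesPlus hn hd hA hφ e ha ha0 _ hp, LinearMap.map_zero₂]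
      refine ⟨h1, ?_⟩
      rw [cupProduct_gradedComm_holds ℂ (ComplexPoints A.X) h224 h224 v p, map_smul, h1, smul_zero]
    have hp := hπm y₀ (hBm J₀)
    have hp' := hπm y₀' (hBm J₀')
    have key : cupProduct h224 (π (Q y₀)) (π (Q y₀')) = (qm * qm) • cupProduct h224 (π y₀) (π y₀') := by
      rw [hQm y₀ (hBm J₀), hQm y₀' (hBm J₀')]
      simp only [map_smul, LinearMap.smul_apply, smul_smul]
    have key2 : cupProduct h848 (TP hn hd hA hφ e ha ha0) (cupProduct h224 (π y₀) (π y₀')) =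
        cupProduct h848 (TP hn hd hA hφ e ha ha0) (cupProduct h224 y₀ y₀') := by
      have eπ : π y₀ = y₀ + (π y₀ - y₀) := by abel
      have eπ' : π y₀' = y₀' + (π y₀' - y₀') := by abel
      rw [eπ, eπ']
      simp only [map_add, LinearMap.add_apply, (hkill _ hp' y₀).2, (hkill _ hp y₀').1, (hkill _ hp (π y₀' - y₀')).1,
        add_zero]
    rw [hE₂, hEz_apply, key, map_smul, key2, map_smul, smul_eq_mul]
    exact mul_ne_zero (mul_ne_zero hqm0 hqm0) fun h0 ↦ TP_cup_monB_cup_monB_ne_zero hn hd hA hφ e ha ha0 J₀ J₀' hJJ h224 h848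
      (eq_zero_of_apply_eq_zero_of_apply_hK_ne hn hd hA hφ e ha ha0 hSU ℓ hℓ h0)
  have hr0 : r = 0 := (mul_eq_zero.1 hLκ).resolve_right (mul_ne_zero hE₂0 hℓ)
  rw [hr, hr0, zero_smul]

end Casimir

end Summit.HodgeConjecture.HodgeConjecture.Theorems.CYFormSquare

end
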